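import Mathlib.Geometry.Manifold.IntegralCurve.ExistUnique
import Literature.Analysis.ODE.SmoothDependence
import HarnessLib

/-!
# Local flows of `C^n` vector fields, maximal integral curves, and their endlessness

General differential topology serving the causality theory of
`Literature.Geometry.Lorentzian.Causality` (the integral curves of a time orientation are the
inextendible timelike curves through every point; O'Neill 1983, Ch. 14, proof of Lemma 14.29
and Prop. 14.31: "Lemma 1.56 and Exercise 1.16 show that maximal integral curves of `X` are
inextendible"). Everything here is **proved**; no definition is introduced (the results are
existential, the maximal curve being characterised by its maximality property).

* `Literature.Geometry.Manifold.exists_localFlow` — about an interior point of a `C^∞` manifold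
  (complete real model) a `C^n` vector field, `1 ≤ n`, has a *`C^n` local flow*: an open
  `U ∋ x₀`, `ε > 0` and `Φ` with `Φ x` an integral curve on `(-ε, ε)` through each `x ∈ U` and
  `(x, t) ↦ Φ x t` of class `C^n` on `U × (-ε, ε)` (Lee 2012, Thm. 9.12, proof; the `C^∞` case
  is `Literature.Topology.FourManifolds.exists_contMDiffOn_localFlow`, whose proof is repeated
  verbatim with `n` for `∞`: the field read in the extended chart at `x₀` is `C^n` on the chart
  domain, `contMDiffOn_tangentCoordChange_apply_of_le`, and its flow on `interior (target)` is
  the tree's `Literature.Analysis.ODE.exists_contDiffOn_flow`, Lang 1995, Ch. IV §1, Thm. 1.14).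
* `Literature.Geometry.Manifold.exists_maximal_integralCurve` — on a Hausdorff manifold all of
  whose points are interior, through every point `x` of a `C¹` vector field `V` there is an
  integral curve `θ` defined on an open interval `D ∋ 0` which is **maximal**: every integral
  curve on an open interval meeting `D` at a time where it agrees with `θ` is a restriction of
  `θ` (Lee 2012, Thm. 9.12 (a); O'Neill 1983, Ch. 1, Lemma 1.56: union of all integral curves
  through `x`, well defined by uniqueness, Mathlib's
  `isMIntegralCurveOn_Ioo_eqOn_of_contMDiff_boundaryless`).
* `Literature.Geometry.Manifold.not_tendsto_atTop_of_maximal`,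
  `…not_tendsto_atBot_of_maximal` — **a maximal integral curve of a nonvanishing `C¹` field has
  no endpoint**: `θ t` does not converge in `M` as `t` increases (decreases) through `D`
  (O'Neill 1983, Ch. 1, Ex. 1.16 / Ch. 14, p. 416; Lee 2012, Lemma 9.19 "escape lemma" in the
  convergent form). Proof: if `θ t → q`, a local flow `(U, ε, Φ)` at `q` either extends `θ`
  beyond `sup D` (bounded case), or — `D` unbounded — gives `Φ q s = lim θ (t + s) = q` for
  small `s`, so the integral curve through `q` is constant and `V q = 0`.

## References

* J. M. Lee, *Introduction to Smooth Manifolds*, 2nd ed., GTM 218 (2012), Ch. 9: Thm. 9.12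
  (fundamental theorem on flows), Lemma 9.19 (escape lemma). [LeeSmoothManifolds2013]
* B. O'Neill, *Semi-Riemannian geometry with applications to relativity*, Academic Press 1983,
  Ch. 1, Lemma 1.56 ff. and Ex. 1.16 (maximal integral curves are inextendible); Ch. 14, proof
  of Prop. 14.31 (p. 416). [ONeillSemiRiemannian1983]
* S. Lang, *Differential and Riemannian Manifolds*, GTM 160 (1995), Ch. IV §1, Thm. 1.14. [Lang1995]
-/

open scoped Manifold ContDiff Topology
open Set Function Filter Metric

noncomputable section

namespace Literature.Geometry.Manifold

universe u

/-! ### Local flows of `C^n` vector fields in a chart -/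

section LocalFlow

variable {E : Type u} [NormedAddCommGroup E] [NormedSpace ℝ E]
  {H : Type*} [TopologicalSpace H] {I : ModelWithCorners ℝ E H}
  {M : Type*} [TopologicalSpace M] [ChartedSpace H M] [IsManifold I ∞ M]
  {V : Π x : M, TangentSpace I x} {n : ℕ∞}

/-- The coordinates, in the chart at `x₀`, of a `C^n` vector field form a function which is
`C^n` on the chart domain (smoothness of a section read in the trivialisation of the tangent
bundle over the chart at `x₀`; the case `n = ∞` is
`Literature.Topology.FourManifolds.contMDiffOn_tangentCoordChange_apply`). [folklore] -/
theorem contMDiffOn_tangentCoordChange_apply_of_le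
    (hV : ContMDiff I I.tangent n fun x => (⟨x, V x⟩ : TangentBundle I M)) (x₀ : M) :
    ContMDiffOn I 𝓘(ℝ, E) n (fun x => tangentCoordChange I x x₀ x (V x)) (chartAt H x₀).source := by
  have h := (Bundle.Trivialization.contMDiffOn_section_baseSet_iff (IB := I) (n := n) (F := E)
    (E := TangentSpace I) (s := V) (trivializationAt E (TangentSpace I) x₀)).1
    (by rw [TangentBundle.trivializationAt_baseSet]; exact hV.contMDiffOn)
  rw [TangentBundle.trivializationAt_baseSet] at h
  refine h.congr fun x _ => ?_
  rw [TangentBundle.trivializationAt_apply, tangentCoordChange_def]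
  rfl

variable [CompleteSpace E]

-- as in Mathlib's `exists_isMIntegralCurveAt_of_contMDiffAt`: the tangent spaces are the
-- model space `E` by definition, which the derivative lemmas must see through
set_option backward.isDefEq.respectTransparency false in
/-- **Local flow of a `C^n` vector field about an interior point** (`1 ≤ n`). For a `C^n` vector
field `V` on a `C^∞` manifold (over a complete real model space) and an interior point `x₀`,
there are an open neighbourhood `U` of `x₀`, `ε > 0` and a map `Φ : M → ℝ → M` such that for
every `x ∈ U` the curve `Φ x` is an integral curve of `V` on `(-ε, ε)` starting at `x`, and
`(x, t) ↦ Φ x t` is `C^n` on `U × (-ε, ε)`. Proof: read `V` in the extended chart `φ` at `x₀`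
(a `C^n` field `w` on the open set `interior φ.target`), take the `C^n` local flow `ψ` of `w`
there (`Literature.Analysis.ODE.exists_contDiffOn_flow`), and set `Φ x t = φ⁻¹ (ψ (φ x) t)`; that
these are integral curves of `V` is the computation of Mathlib's
`exists_isMIntegralCurveAt_of_contMDiffAt`. Lee 2012, Thm. 9.12 (proof: local flows in
charts); Lang 1995, Ch. IV §1, Thm. 1.14. [cite: LeeSmoothManifolds2013, Thm. 9.12 (proof: local flows in charts)] -/
theorem exists_localFlow
    (hV : ContMDiff I I.tangent n fun x => (⟨x, V x⟩ : TangentBundle I M)) (hn : 1 ≤ n)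
    {x₀ : M} (hx₀ : I.IsInteriorPoint x₀) :
    ∃ U : Set M, IsOpen U ∧ x₀ ∈ U ∧ ∃ ε > (0 : ℝ), ∃ Φ : M → ℝ → M,
      (∀ x ∈ U, Φ x 0 = x) ∧ (∀ x ∈ U, IsMIntegralCurveOn (Φ x) V (Ioo (-ε) ε)) ∧
      ContMDiffOn (I.prod 𝓘(ℝ, ℝ)) I n (fun p : M × ℝ => Φ p.1 p.2) (U ×ˢ Ioo (-ε) ε) := by
  set φ := extChartAt I x₀ with hφ
  set O : Set E := interior φ.target with hO
  have hOo : IsOpen O := isOpen_interior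
  have hOsub : O ⊆ φ.target := interior_subset
  have hx₀' : φ x₀ ∈ O := I.isInteriorPoint_iff.1 hx₀
  -- the field in the chart
  set W : M → E := fun x => tangentCoordChange I x x₀ x (V x) with hW
  have hWs : ContMDiffOn I 𝓘(ℝ, E) n W (chartAt H x₀).source :=
    contMDiffOn_tangentCoordChange_apply_of_le hV x₀
  set w : E → E := W ∘ φ.symm with hw
  have hwO : ContDiffOn ℝ n w O := by
    have h1 : ContMDiffOn 𝓘(ℝ, E) 𝓘(ℝ, E) n w φ.target :=
      hWs.comp (contMDiffOn_extChartAt_symm x₀) fun y hy => by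
        rw [← extChartAt_source I]; exact φ.map_target hy
    exact (contMDiffOn_iff_contDiffOn.1 h1).mono interior_subset
  -- the local flow in the chart
  obtain ⟨ψ, r, hr, ε, hε, hψ0, hψd, hψO, hψs⟩ :=
    Literature.Analysis.ODE.exists_contDiffOn_flow (n := n) hOo hwO hn hx₀'
  set U : Set M := φ.source ∩ φ ⁻¹' ball (φ x₀) r with hU
  have hUo : IsOpen U := isOpen_extChartAt_preimage' x₀ isOpen_ball
  have hx₀U : x₀ ∈ U := ⟨mem_extChartAt_source x₀, mem_ball_self hr⟩
  set Φ : M → ℝ → M := fun x t => φ.symm (ψ (φ x) t) with hΦ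
  refine ⟨U, hUo, hx₀U, ε, hε, Φ, fun x hx => ?_, fun x hx t ht => ?_, ?_⟩
  · -- initial condition
    simp only [hΦ, hψ0 (φ x) hx.2, φ.left_inv hx.1]
  · -- integral curves (as in Mathlib's `exists_isMIntegralCurveAt_of_contMDiffAt`)
    have hf3 : ψ (φ x) t ∈ interior φ.target := hψO (φ x) hx.2 t ht
    have hf3' : ψ (φ x) t ∈ φ.target := hOsub hf3
    set xₜ : M := φ.symm (ψ (φ x) t) with hxₜ
    have h : HasDerivAt (ψ (φ x)) (tangentCoordChange I xₜ x₀ xₜ (V xₜ)) t := hψd (φ x) hx.2 t ht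
    have hft1 : xₜ ∈ (extChartAt I x₀).source := φ.map_target hf3'
    have hft2 := mem_extChartAt_source (I := I) xₜ
    apply HasMFDerivAt.hasMFDerivWithinAt
    refine ⟨(continuousAt_extChartAt_symm'' hf3').comp h.continuousAt,
      HasDerivWithinAt.hasFDerivWithinAt ?_⟩
    simp only [mfld_simps, hasDerivWithinAt_univ]
    change HasDerivAt ((extChartAt I xₜ ∘ (extChartAt I x₀).symm) ∘ ψ (φ x)) (V xₜ) t
    rw [← tangentCoordChange_self (I := I) (x := xₜ) (z := xₜ) (v := V xₜ) hft2,
      ← tangentCoordChange_comp (x := x₀) ⟨⟨hft2, hft1⟩, hft2⟩]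
    apply HasFDerivAt.comp_hasDerivAt _ _ h
    apply HasFDerivWithinAt.hasFDerivAt (s := range I) _ <|
      mem_nhds_iff.mpr ⟨interior (extChartAt I x₀).target,
        subset_trans interior_subset (extChartAt_target_subset_range ..),
        isOpen_interior, hf3⟩
    rw [← (extChartAt I x₀).right_inv hf3']
    exact hasFDerivWithinAt_tangentCoordChange ⟨hft1, hft2⟩
  · -- smoothness of `(x, t) ↦ φ⁻¹ (ψ (φ x) t)`
    have h1 : ContMDiffOn (I.prod 𝓘(ℝ, ℝ)) 𝓘(ℝ, E × ℝ) n (fun p : M × ℝ => (φ p.1, p.2))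
        (U ×ˢ Ioo (-ε) ε) := by
      refine ContMDiffOn.prodMk_space ?_ contMDiffOn_snd
      exact (contMDiffOn_extChartAt (x := x₀)).comp contMDiffOn_fst fun p hp => by
        rw [← extChartAt_source I]; exact hp.1.1
    have h2 : ContMDiffOn 𝓘(ℝ, E × ℝ) 𝓘(ℝ, E) n (fun q : E × ℝ => ψ q.1 q.2)
        (ball (φ x₀) r ×ˢ Ioo (-ε) ε) := contMDiffOn_iff_contDiffOn.2 hψs
    have h3 : ContMDiffOn 𝓘(ℝ, E) I n φ.symm φ.target := contMDiffOn_extChartAt_symm x₀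
    have h23 : ContMDiffOn 𝓘(ℝ, E × ℝ) I n (fun q : E × ℝ => φ.symm (ψ q.1 q.2))
        (ball (φ x₀) r ×ˢ Ioo (-ε) ε) :=
      h3.comp h2 fun q hq => hOsub (hψO q.1 hq.1 q.2 hq.2)
    exact h23.comp h1 fun p hp => ⟨hp.1.2, hp.2⟩

end LocalFlow

/-! ### Integral curves on open intervals: uniqueness -/

section Maximal

variable {E : Type u} [NormedAddCommGroup E] [NormedSpace ℝ E] [CompleteSpace E]
  {H : Type*} [TopologicalSpace H] {I : ModelWithCorners ℝ E H}
  {M : Type*} [TopologicalSpace M] [ChartedSpace H M] [IsManifold I ∞ M]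
  [T2Space M] [BoundarylessManifold I M]
  {V : Π x : M, TangentSpace I x}

omit [CompleteSpace E] [IsManifold I ∞ M] [T2Space M] [BoundarylessManifold I M] in
/-- An open order-connected subset of `ℝ` containing `t₀` and `t` contains an open interval
around the closed interval between them. [folklore] -/
theorem exists_Ioo_subset_of_isOpen_ordConnected {J : Set ℝ} (hJ : IsOpen J)
    (hJc : J.OrdConnected) {t₀ t : ℝ} (ht₀ : t₀ ∈ J) (ht : t ∈ J) :
    ∃ a b, a < min t₀ t ∧ max t₀ t < b ∧ Ioo a b ⊆ J := by
  have hmin : min t₀ t ∈ J := by rcases le_total t₀ t with h | h <;> simp [h, ht₀, ht]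
  have hmax : max t₀ t ∈ J := by rcases le_total t₀ t with h | h <;> simp [h, ht₀, ht]
  obtain ⟨δ₁, hδ₁, h₁⟩ := Metric.isOpen_iff.1 hJ _ hmin
  obtain ⟨δ₂, hδ₂, h₂⟩ := Metric.isOpen_iff.1 hJ _ hmax
  refine ⟨min t₀ t - δ₁, max t₀ t + δ₂, by linarith, by linarith, fun s hs => ?_⟩
  rcases lt_or_ge s (min t₀ t) with hs₁ | hs₁
  · exact h₁ (by rw [Real.ball_eq_Ioo]; exact ⟨hs.1, by linarith⟩)
  rcases le_or_gt s (max t₀ t) with hs₂ | hs₂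
  · exact hJc.out hmin hmax ⟨hs₁, hs₂⟩
  · exact h₂ (by rw [Real.ball_eq_Ioo]; exact ⟨by linarith, hs.2⟩)

omit [CompleteSpace E] in
/-- **Uniqueness of integral curves on open intervals** (any open order-connected parameter set,
bounded or not): two integral curves of a `C¹` field on `J` agreeing at one time of `J` agree on
`J`. Mathlib's `isMIntegralCurveOn_Ioo_eqOn_of_contMDiff_boundaryless`, spread over `J`.
Lee 2012, Thm. 9.12 (a). [cite: LeeSmoothManifolds2013, Thm. 9.12 (a)] -/
theorem eqOn_of_isMIntegralCurveOn
    (hV : ContMDiff I I.tangent 1 fun x => (⟨x, V x⟩ : TangentBundle I M))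
    {γ γ' : ℝ → M} {J : Set ℝ} (hJ : IsOpen J) (hJc : J.OrdConnected) {t₀ : ℝ} (ht₀ : t₀ ∈ J)
    (hγ : IsMIntegralCurveOn γ V J) (hγ' : IsMIntegralCurveOn γ' V J) (h : γ t₀ = γ' t₀) :
    EqOn γ γ' J := by
  intro t ht
  obtain ⟨a, b, ha, hb, hsub⟩ := exists_Ioo_subset_of_isOpen_ordConnected hJ hJc ht₀ ht
  have ht₀' : t₀ ∈ Ioo a b := ⟨by have := min_le_left t₀ t; linarith, by
    have := le_max_left t₀ t; linarith⟩
  have ht' : t ∈ Ioo a b := ⟨by have := min_le_right t₀ t; linarith, by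
    have := le_max_right t₀ t; linarith⟩
  exact isMIntegralCurveOn_Ioo_eqOn_of_contMDiff_boundaryless ht₀' hV (hγ.mono hsub)
    (hγ'.mono hsub) h ht'

omit [CompleteSpace E] [T2Space M] [BoundarylessManifold I M] [IsManifold I ∞ M] in
/-- An integral curve on an open set is an integral curve at each of its points, with the
two-sided derivative (dot-notation extension of Mathlib's `IsMIntegralCurveOn`, deliberately in
the root namespace). [folklore] -/
theorem _root_.IsMIntegralCurveOn.hasMFDerivAt_of_isOpen {γ : ℝ → M} {J : Set ℝ} (hJ : IsOpen J)
    (hγ : IsMIntegralCurveOn γ V J) {t : ℝ} (ht : t ∈ J) :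
    HasMFDerivAt 𝓘(ℝ, ℝ) I γ t ((1 : ℝ →L[ℝ] ℝ).smulRight (V (γ t))) :=
  (hγ t ht).hasMFDerivAt (hJ.mem_nhds ht)

omit [CompleteSpace E] [T2Space M] [BoundarylessManifold I M] [IsManifold I ∞ M] in
/-- Integral curves only depend on the curve near the parameter set: if `γ' = γ` on an open set
`J` on which `γ` is an integral curve, so is `γ'` (dot-notation extension of Mathlib's
`IsMIntegralCurveOn`, deliberately in the root namespace). [folklore] -/
theorem _root_.IsMIntegralCurveOn.congr_of_eqOn_isOpen {γ γ' : ℝ → M} {J : Set ℝ} (hJ : IsOpen J)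
    (hγ : IsMIntegralCurveOn γ V J) (h : EqOn γ' γ J) : IsMIntegralCurveOn γ' V J := by
  intro t ht
  have hev : γ' =ᶠ[𝓝 t] γ := eventuallyEq_of_mem (hJ.mem_nhds ht) h
  have hd := (hγ.hasMFDerivAt_of_isOpen hJ ht).congr_of_eventuallyEq hev
  have hval : V (γ' t) = V (γ t) := by rw [h ht]
  rw [hval]
  exact hd.hasMFDerivWithinAt

/-! ### Maximal integral curves -/

/-- **Existence of maximal integral curves.** On a Hausdorff `C^∞` manifold all of whose points
are interior (complete real model), through every point `x` of a `C¹` vector field `V` there is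
an integral curve `θ` defined on an open interval `D ∋ 0` (an open order-connected set) with
`θ 0 = x`, which is **maximal**: any integral curve `γ` of `V` on an open interval `J` which
agrees with `θ` at some `t₀ ∈ J ∩ D` is defined inside `D` (`J ⊆ D`) and coincides with `θ` on
`J`. Construction: `D` is the union of the domains of all integral curves through `x` on open
intervals containing `0`, and `θ` their common value (well defined by uniqueness,
`eqOn_of_isMIntegralCurveOn`). Lee 2012, Thm. 9.12 (a) ("the unique maximal integral curve of
`V` starting at `p`"); O'Neill 1983, Ch. 1, Lemma 1.56 ff. [cite: LeeSmoothManifolds2013, Thm. 9.12 (a)] -/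
theorem exists_maximal_integralCurve
    (hV : ContMDiff I I.tangent 1 fun x => (⟨x, V x⟩ : TangentBundle I M)) (x : M) :
    ∃ (θ : ℝ → M) (D : Set ℝ), IsOpen D ∧ D.OrdConnected ∧ 0 ∈ D ∧ θ 0 = x ∧
      IsMIntegralCurveOn θ V D ∧
      ∀ (γ : ℝ → M) (J : Set ℝ), IsOpen J → J.OrdConnected → ∀ t₀ ∈ J, t₀ ∈ D → γ t₀ = θ t₀ →
        IsMIntegralCurveOn γ V J → J ⊆ D ∧ EqOn γ θ J := by
  classical
  -- the integral curves through `x` on open intervals containing `0`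
  set S : Set ((ℝ → M) × Set ℝ) := {p | IsOpen p.2 ∧ p.2.OrdConnected ∧ 0 ∈ p.2 ∧ p.1 0 = x ∧
    IsMIntegralCurveOn p.1 V p.2} with hS
  -- consistency: two of them agree on the intersection of their domains
  have hcons : ∀ p ∈ S, ∀ q ∈ S, ∀ t ∈ p.2 ∩ q.2, p.1 t = q.1 t := by
    intro p hp q hq t ht
    exact eqOn_of_isMIntegralCurveOn hV (hp.1.inter hq.1) (hp.2.1.inter hq.2.1) ⟨hp.2.2.1, hq.2.2.1⟩
      (hp.2.2.2.2.mono inter_subset_left) (hq.2.2.2.2.mono inter_subset_right)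
      (hp.2.2.2.1.trans hq.2.2.2.1.symm) ht
  set D : Set ℝ := ⋃ p ∈ S, p.2 with hD
  have hmemD : ∀ {t}, t ∈ D ↔ ∃ p ∈ S, t ∈ p.2 := by
    intro t; simp only [hD, mem_iUnion, exists_prop]
  have hD' : ∀ t, ∃ p : (ℝ → M) × Set ℝ, t ∈ D → p ∈ S ∧ t ∈ p.2 := by
    intro t
    by_cases ht : t ∈ D
    · obtain ⟨p, hp, htp⟩ := hmemD.1 ht
      exact ⟨p, fun _ => ⟨hp, htp⟩⟩
    · exact ⟨(fun _ => x, ∅), fun h => (ht h).elim⟩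
  choose P hP using hD'
  set θ : ℝ → M := fun t => (P t).1 t with hθ
  -- `θ` agrees with every member of `S` on its domain
  have hθeq : ∀ p ∈ S, EqOn θ p.1 p.2 := by
    intro p hp t ht
    have htD : t ∈ D := hmemD.2 ⟨p, hp, ht⟩
    exact hcons (P t) (hP t htD).1 p hp t ⟨(hP t htD).2, ht⟩
  -- `S` is nonempty: local existence at `x`
  obtain ⟨γ₀, hγ₀x, hγ₀⟩ :=
    exists_isMIntegralCurveAt_of_contMDiffAt_boundaryless (I := I) (v := V) 0 hV.contMDiffAt
      (x₀ := x)
  obtain ⟨ε₀, hε₀, hγ₀'⟩ := isMIntegralCurveAt_iff'.1 hγ₀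
  have hp₀ : (γ₀, Metric.ball (0 : ℝ) ε₀) ∈ S := by
    refine ⟨Metric.isOpen_ball, ?_, Metric.mem_ball_self hε₀, hγ₀x, hγ₀'⟩
    rw [Real.ball_eq_Ioo]; exact ordConnected_Ioo
  have h0D : (0 : ℝ) ∈ D := hmemD.2 ⟨_, hp₀, Metric.mem_ball_self hε₀⟩
  -- `D` is open and order connected
  have hDo : IsOpen D := isOpen_biUnion fun p hp => hp.1
  have hDc : D.OrdConnected := by
    refine ⟨fun a ha b hb u hu => ?_⟩
    rcases le_total 0 u with hu0 | hu0
    · obtain ⟨p, hp, hbp⟩ := hmemD.1 hb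
      exact hmemD.2 ⟨p, hp, hp.2.1.out hp.2.2.1 hbp ⟨hu0, hu.2⟩⟩
    · obtain ⟨p, hp, hap⟩ := hmemD.1 ha
      exact hmemD.2 ⟨p, hp, hp.2.1.out hap hp.2.2.1 ⟨hu.1, hu0⟩⟩
  -- `θ` is an integral curve on `D`
  have hθint : IsMIntegralCurveOn θ V D := by
    intro t ht
    obtain ⟨p, hp, htp⟩ := hmemD.1 ht
    have h1 : IsMIntegralCurveOn θ V p.2 :=
      hp.2.2.2.2.congr_of_eqOn_isOpen hp.1 (hθeq p hp)
    exact ((h1.hasMFDerivAt_of_isOpen hp.1 htp).hasMFDerivWithinAt (s := D))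
  have hθ0 : θ 0 = x := (hθeq _ hp₀ (Metric.mem_ball_self hε₀)).trans hγ₀x
  refine ⟨θ, D, hDo, hDc, h0D, hθ0, hθint, fun γ J hJ hJc t₀ ht₀J ht₀D hγt₀ hγ => ?_⟩
  -- maximality: glue `γ` with the member of `S` through `t₀`
  obtain ⟨p₁, hp₁, ht₀p₁⟩ := hmemD.1 ht₀D
  -- `γ = p₁.1` on `J ∩ p₁.2`
  have hagree : EqOn γ p₁.1 (J ∩ p₁.2) :=
    eqOn_of_isMIntegralCurveOn hV (hJ.inter hp₁.1) (hJc.inter hp₁.2.1) ⟨ht₀J, ht₀p₁⟩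
      (hγ.mono inter_subset_left) (hp₁.2.2.2.2.mono inter_subset_right)
      (hγt₀.trans (hθeq p₁ hp₁ ht₀p₁))
  set γ₂ : ℝ → M := p₁.2.piecewise p₁.1 γ with hγ₂
  have hγ₂J : EqOn γ₂ γ J := by
    intro t ht
    by_cases htp : t ∈ p₁.2
    · rw [hγ₂, piecewise_eq_of_mem _ _ _ htp]; exact (hagree ⟨ht, htp⟩).symm
    · rw [hγ₂, piecewise_eq_of_notMem _ _ _ htp]
  have hγ₂p : EqOn γ₂ p₁.1 p₁.2 := fun t ht => by rw [hγ₂, piecewise_eq_of_mem _ _ _ ht]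
  have hp₂ : (γ₂, J ∪ p₁.2) ∈ S := by
    refine ⟨hJ.union hp₁.1, ?_, Or.inr hp₁.2.2.1, ?_, ?_⟩
    · -- union of two overlapping intervals
      refine ⟨fun a ha b hb u hu => ?_⟩
      have key : ∀ {a b u : ℝ}, a ∈ J ∪ p₁.2 → b ∈ J ∪ p₁.2 → u ∈ Icc a b → u ∈ J ∪ p₁.2 := by
        intro a b u ha hb hu
        rcases ha with ha | ha <;> rcases hb with hb | hb
        · exact Or.inl (hJc.out ha hb hu)
        · -- `a ∈ J`, `b ∈ p₁.2`, `t₀` in both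
          rcases le_total u t₀ with h | h
          · exact Or.inl (hJc.out ha ht₀J ⟨hu.1, h⟩)
          · exact Or.inr (hp₁.2.1.out ht₀p₁ hb ⟨h, hu.2⟩)
        · rcases le_total u t₀ with h | h
          · exact Or.inr (hp₁.2.1.out ha ht₀p₁ ⟨hu.1, h⟩)
          · exact Or.inl (hJc.out ht₀J hb ⟨h, hu.2⟩)
        · exact Or.inr (hp₁.2.1.out ha hb hu)
      exact key ha hb hu
    · show γ₂ 0 = x
      rw [hγ₂p hp₁.2.2.1]; exact hp₁.2.2.2.1
    · show IsMIntegralCurveOn γ₂ V (J ∪ p₁.2)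
      intro t ht
      rcases ht with ht | ht
      · have h1 : IsMIntegralCurveOn γ₂ V J := hγ.congr_of_eqOn_isOpen hJ hγ₂J
        exact (h1.hasMFDerivAt_of_isOpen hJ ht).hasMFDerivWithinAt
      · have h1 : IsMIntegralCurveOn γ₂ V p₁.2 := hp₁.2.2.2.2.congr_of_eqOn_isOpen hp₁.1 hγ₂p
        exact (h1.hasMFDerivAt_of_isOpen hp₁.1 ht).hasMFDerivWithinAt
  have hJD : J ⊆ D := fun t ht => hmemD.2 ⟨_, hp₂, Or.inl ht⟩
  refine ⟨hJD, fun t ht => ?_⟩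
  rw [← hγ₂J ht]
  exact (hθeq _ hp₂ (Or.inl ht)).symm


/-! ### Maximal integral curves of nonvanishing fields have no endpoints -/

omit [CompleteSpace E] [IsManifold I ∞ M] [T2Space M] [BoundarylessManifold I M] in
/-- Time reversal of integral curves on a parameter set: `γ ∘ Neg.neg` is an integral curve of
`-V` on `-J` (dot-notation extension of Mathlib's `IsMIntegralCurveOn`, deliberately in the root
namespace). [folklore] -/
theorem _root_.IsMIntegralCurveOn.comp_neg' {γ : ℝ → M} {J : Set ℝ} (hγ : IsMIntegralCurveOn γ V J) :
    IsMIntegralCurveOn (γ ∘ Neg.neg) (-V) {t | -t ∈ J} := by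
  have h := hγ.comp_mul (-1)
  have h1 : (γ ∘ fun t : ℝ => t * (-1)) = γ ∘ Neg.neg := by
    ext t; simp
  have h2 : ((-1 : ℝ) • V) = -V := by
    ext x; simp
  have h3 : {t : ℝ | t * (-1) ∈ J} = {t | -t ∈ J} := by
    ext t; simp
  rw [h1, h2, h3] at h
  exact h

-- the tangent spaces are the model space by definition (cross-fibre equation `V q = 0`)
set_option backward.isDefEq.respectTransparency false in
/-- **A maximal integral curve of a nonvanishing `C¹` vector field has no future endpoint**:
if `θ` is an integral curve of `V` on the open interval `D` with the maximality property
(every integral curve on an open interval agreeing with `θ` at a time of `D` has its interval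
inside `D`) and `V` vanishes nowhere, then `θ t` has no limit in `M` as `t` increases through
`D`. O'Neill 1983, Ch. 1, Ex. 1.16 (with Lemma 1.56) and Ch. 14, proof of Prop. 14.31 ("maximal
integral curves of `X` are inextendible"); Lee 2012, Lemma 9.19 (escape lemma). Proof: if
`θ t → q`, take a local flow `(U, ε, Φ)` at `q`; if `D` is bounded above, the integral curve
`s ↦ Φ (θ t₁) (s - t₁)` through `θ t₁`, `t₁ > sup D - ε`, forces `(t₁ - ε, t₁ + ε) ⊆ D`; if `D`
is unbounded above, `θ (t + s) = Φ (θ t) s → Φ q s`, so `Φ q s = q` for `0 ≤ s < ε` and the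
integral curve through `q` is constant, whence `V q = 0`. [cite: ONeillSemiRiemannian1983, Ch. 1, Ex. 1.16 and Ch. 14, proof of Prop. 14.31 (p. 416)] -/
theorem not_tendsto_atTop_of_maximal
    (hV : ContMDiff I I.tangent 1 fun x => (⟨x, V x⟩ : TangentBundle I M)) (hV0 : ∀ x, V x ≠ 0)
    {θ : ℝ → M} {D : Set ℝ} (hDo : IsOpen D) (hDc : D.OrdConnected) (hDn : D.Nonempty)
    (hθ : IsMIntegralCurveOn θ V D)
    (hmax : ∀ (γ : ℝ → M) (J : Set ℝ), IsOpen J → J.OrdConnected → ∀ t₀ ∈ J, t₀ ∈ D →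
      γ t₀ = θ t₀ → IsMIntegralCurveOn γ V J → J ⊆ D)
    (q : M) : ¬ Tendsto (fun t : D => θ t) atTop (𝓝 q) := by
  intro hlim
  haveI : Nonempty D := hDn.to_subtype
  -- a local flow at `q`
  obtain ⟨U, hUo, hqU, ε, hε, Φ, hΦ0, hΦint, hΦsmooth⟩ :=
    exists_localFlow (n := 1) hV le_rfl (BoundarylessManifold.isInteriorPoint (x := q))
  -- eventually `θ t ∈ U`
  obtain ⟨t₁, ht₁⟩ : ∃ t₁ : D, ∀ t ≥ t₁, θ t ∈ U :=
    eventually_atTop.1 (hlim (hUo.mem_nhds hqU))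
  -- the integral curve of the local flow through `θ t`, `t ∈ D`, `θ t ∈ U`, is inside `D`
  have hflowD : ∀ t ∈ D, θ t ∈ U → Ioo (t - ε) (t + ε) ⊆ D := by
    intro t htD htU
    have hcurve : IsMIntegralCurveOn (Φ (θ t) ∘ (· + -t)) V {s | s + -t ∈ Ioo (-ε) ε} :=
      (hΦint (θ t) htU).comp_add (-t)
    have hset : {s : ℝ | s + -t ∈ Ioo (-ε) ε} = Ioo (t - ε) (t + ε) := by
      ext s; simp only [mem_setOf_eq, mem_Ioo]; constructor <;> intro h <;> constructor <;> linarith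
    rw [hset] at hcurve
    refine hmax _ _ isOpen_Ioo ordConnected_Ioo t ⟨by linarith, by linarith⟩ htD ?_ hcurve
    simp [hΦ0 (θ t) htU]
  by_cases hbdd : BddAbove D
  · -- bounded case: extend beyond `sup D`
    set b := sSup D with hb
    have hbD : b ∉ D := fun hbD => by
      obtain ⟨δ, hδ, hball⟩ := Metric.isOpen_iff.1 hDo b hbD
      have : b + δ / 2 ∈ D := hball (by rw [Real.ball_eq_Ioo]; constructor <;> linarith)
      have := le_csSup hbdd this
      linarith
    have ht₁b : (t₁ : ℝ) < b := lt_of_le_of_ne (le_csSup hbdd t₁.2) fun h => hbD (h ▸ t₁.2)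
    obtain ⟨t, htD, ht⟩ := exists_lt_of_lt_csSup hDn
      (show max (t₁ : ℝ) (b - ε / 2) < sSup D from max_lt ht₁b (by rw [← hb]; linarith))
    have htU : θ t ∈ U := ht₁ ⟨t, htD⟩ (Subtype.mk_le_mk.2 ((le_max_left _ _).trans ht.le))
    have hsub := hflowD t htD htU
    have : t + ε / 2 ∈ D := hsub ⟨by linarith, by linarith⟩
    have h1 := le_csSup hbdd this
    have h2 : b - ε / 2 < t := (le_max_right _ _).trans_lt ht
    rw [← hb] at h1
    linarith
  · -- unbounded case: `D ⊇ [t₁, ∞)` and `θ → q` at `+∞`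
    have hIci : ∀ t ∈ D, Ici t ⊆ D := fun t ht s hs => by
      obtain ⟨u, huD, hsu⟩ : ∃ u ∈ D, s < u := by
        by_contra hcon
        push Not at hcon
        exact hbdd ⟨s, fun u hu => (hcon u hu)⟩
      exact hDc.out ht huD ⟨hs, hsu.le⟩
    have hlim' : Tendsto θ atTop (𝓝 q) := by
      have hmap := Filter.map_val_atTop_of_Ici_subset (hIci t₁ t₁.2)
      rw [← hmap, tendsto_map'_iff]
      exact hlim
    -- `θ (t + s) = Φ (θ t) s` for `t ≥ t₁ + ε`, `s ∈ (-ε, ε)`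
    have hshift : ∀ t, (t₁ : ℝ) + ε ≤ t → ∀ s ∈ Ioo (-ε) ε, θ (t + s) = Φ (θ t) s := by
      intro t ht s hs
      have htD : t ∈ D := hIci t₁ t₁.2 (show (t₁ : ℝ) ≤ t by linarith)
      have htU : θ t ∈ U := ht₁ ⟨t, htD⟩ (Subtype.mk_le_mk.2 (by linarith))
      have h1 : IsMIntegralCurveOn (θ ∘ (· + t)) V (Ioo (-ε) ε) := by
        refine (hθ.comp_add t).mono fun s hs => ?_
        exact hIci t₁ t₁.2 (show (t₁ : ℝ) ≤ s + t by have := hs.1; linarith)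
      have h2 : IsMIntegralCurveOn (Φ (θ t)) V (Ioo (-ε) ε) := hΦint (θ t) htU
      have h0 : (θ ∘ (· + t)) 0 = Φ (θ t) 0 := by simp [hΦ0 (θ t) htU]
      have := isMIntegralCurveOn_Ioo_eqOn_of_contMDiff_boundaryless
        (t₀ := 0) ⟨by linarith, hε⟩ hV h1 h2 h0 hs
      simpa [add_comm] using this
    -- hence `Φ q s = q` for `s ∈ [0, ε)`
    have hfix : ∀ s ∈ Ioo (-ε) ε, Φ q s = q := by
      intro s hs
      -- `x ↦ Φ x s` is continuous at `q`
      have hcont : ContinuousAt (fun x => Φ x s) q := by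
        have h1 : ContinuousWithinAt (fun p : M × ℝ => Φ p.1 p.2) (U ×ˢ Ioo (-ε) ε) (q, s) :=
          (hΦsmooth.continuousOn (q, s) ⟨hqU, hs⟩)
        have h2 : ContinuousAt (fun p : M × ℝ => Φ p.1 p.2) (q, s) :=
          h1.continuousAt ((hUo.prod isOpen_Ioo).mem_nhds ⟨hqU, hs⟩)
        have h3 : ContinuousAt (fun x : M => (x, s)) q :=
          (continuous_id.prodMk continuous_const).continuousAt
        exact h2.comp_of_eq h3 rfl
      have hA : Tendsto (fun t => Φ (θ t) s) atTop (𝓝 (Φ q s)) := hcont.tendsto.comp hlim'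
      have hB : Tendsto (fun t => θ (t + s)) atTop (𝓝 q) :=
        hlim'.comp (tendsto_atTop_add_const_right _ s tendsto_id)
      have hAB : (fun t => θ (t + s)) =ᶠ[atTop] fun t => Φ (θ t) s := by
        filter_upwards [eventually_ge_atTop ((t₁ : ℝ) + ε)] with t ht
        exact hshift t ht s hs
      exact (tendsto_nhds_unique (hB.congr' hAB) hA).symm
    -- the integral curve through `q` is constant near `ε / 2`: `V q = 0`
    have hε2 : ε / 2 ∈ Ioo (-ε) ε := ⟨by linarith, by linarith⟩
    have hd1 : HasMFDerivAt 𝓘(ℝ, ℝ) I (Φ q) (ε / 2)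
        ((1 : ℝ →L[ℝ] ℝ).smulRight (V (Φ q (ε / 2)))) :=
      (hΦint q hqU).hasMFDerivAt_of_isOpen isOpen_Ioo hε2
    have hev : (fun _ : ℝ => q) =ᶠ[𝓝 (ε / 2)] Φ q := by
      filter_upwards [isOpen_Ioo.mem_nhds hε2] with s hs
      exact (hfix s hs).symm
    have hd2 : HasMFDerivAt 𝓘(ℝ, ℝ) I (fun _ : ℝ => q) (ε / 2)
        ((1 : ℝ →L[ℝ] ℝ).smulRight (V (Φ q (ε / 2)))) :=
      hd1.congr_of_eventuallyEq hev
    have hd3 : HasMFDerivAt 𝓘(ℝ, ℝ) I (fun _ : ℝ => q) (ε / 2)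
        (0 : TangentSpace 𝓘(ℝ, ℝ) (ε / 2) →L[ℝ] TangentSpace I q) :=
      hasMFDerivAt_const q (ε / 2)
    have heq := (uniqueMDiffWithinAt_univ 𝓘(ℝ, ℝ)).eq hd2.hasMFDerivWithinAt hd3.hasMFDerivWithinAt
    have : V (Φ q (ε / 2)) = 0 := by
      have := congrArg (fun L : TangentSpace 𝓘(ℝ, ℝ) (ε / 2) →L[ℝ] TangentSpace I q =>
        L (show TangentSpace 𝓘(ℝ, ℝ) (ε / 2) from (1 : ℝ))) heq
      change ((1 : ℝ →L[ℝ] ℝ).smulRight (V (Φ q (ε / 2)))) (1 : ℝ) =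
        (0 : ℝ →L[ℝ] TangentSpace I q) (1 : ℝ) at this
      simpa using this
    rw [hfix _ hε2] at this
    exact hV0 q this


-- the tangent spaces are the model space by definition (cross-fibre equation `V q = 0`)
set_option backward.isDefEq.respectTransparency false in
/-- **A maximal integral curve of a nonvanishing `C¹` vector field has no past endpoint**
(time dual of `not_tendsto_atTop_of_maximal`, same proof with `inf D` and `t → -∞`): `θ t` has
no limit in `M` as `t` decreases through `D`. O'Neill 1983, Ch. 1, Ex. 1.16 and Ch. 14, proof of
Prop. 14.31; Lee 2012, Lemma 9.19. [cite: ONeillSemiRiemannian1983, Ch. 1, Ex. 1.16 and Ch. 14, proof of Prop. 14.31 (p. 416)] -/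
theorem not_tendsto_atBot_of_maximal
    (hV : ContMDiff I I.tangent 1 fun x => (⟨x, V x⟩ : TangentBundle I M)) (hV0 : ∀ x, V x ≠ 0)
    {θ : ℝ → M} {D : Set ℝ} (hDo : IsOpen D) (hDc : D.OrdConnected) (hDn : D.Nonempty)
    (hθ : IsMIntegralCurveOn θ V D)
    (hmax : ∀ (γ : ℝ → M) (J : Set ℝ), IsOpen J → J.OrdConnected → ∀ t₀ ∈ J, t₀ ∈ D →
      γ t₀ = θ t₀ → IsMIntegralCurveOn γ V J → J ⊆ D)
    (q : M) : ¬ Tendsto (fun t : D => θ t) atBot (𝓝 q) := by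
  intro hlim
  haveI : Nonempty D := hDn.to_subtype
  -- a local flow at `q`
  obtain ⟨U, hUo, hqU, ε, hε, Φ, hΦ0, hΦint, hΦsmooth⟩ :=
    exists_localFlow (n := 1) hV le_rfl (BoundarylessManifold.isInteriorPoint (x := q))
  -- eventually `θ t ∈ U`
  obtain ⟨t₁, ht₁⟩ : ∃ t₁ : D, ∀ t ≤ t₁, θ t ∈ U :=
    eventually_atBot.1 (hlim (hUo.mem_nhds hqU))
  -- the integral curve of the local flow through `θ t`, `t ∈ D`, `θ t ∈ U`, is inside `D`
  have hflowD : ∀ t ∈ D, θ t ∈ U → Ioo (t - ε) (t + ε) ⊆ D := by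
    intro t htD htU
    have hcurve : IsMIntegralCurveOn (Φ (θ t) ∘ (· + -t)) V {s | s + -t ∈ Ioo (-ε) ε} :=
      (hΦint (θ t) htU).comp_add (-t)
    have hset : {s : ℝ | s + -t ∈ Ioo (-ε) ε} = Ioo (t - ε) (t + ε) := by
      ext s; simp only [mem_setOf_eq, mem_Ioo]; constructor <;> intro h <;> constructor <;> linarith
    rw [hset] at hcurve
    refine hmax _ _ isOpen_Ioo ordConnected_Ioo t ⟨by linarith, by linarith⟩ htD ?_ hcurve
    simp [hΦ0 (θ t) htU]
  by_cases hbdd : BddBelow D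
  · -- bounded case: extend beyond `inf D`
    set b := sInf D with hb
    have hbD : b ∉ D := fun hbD => by
      obtain ⟨δ, hδ, hball⟩ := Metric.isOpen_iff.1 hDo b hbD
      have : b - δ / 2 ∈ D := hball (by rw [Real.ball_eq_Ioo]; constructor <;> linarith)
      have := csInf_le hbdd this
      linarith
    have ht₁b : b < (t₁ : ℝ) := lt_of_le_of_ne (csInf_le hbdd t₁.2) fun h => hbD (h ▸ t₁.2)
    obtain ⟨t, htD, ht⟩ := exists_lt_of_csInf_lt hDn
      (show sInf D < min (t₁ : ℝ) (b + ε / 2) from lt_min ht₁b (by rw [← hb]; linarith))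
    have htU : θ t ∈ U := ht₁ ⟨t, htD⟩ (Subtype.mk_le_mk.2 (ht.le.trans (min_le_left _ _)))
    have hsub := hflowD t htD htU
    have : t - ε / 2 ∈ D := hsub ⟨by linarith, by linarith⟩
    have h1 := csInf_le hbdd this
    have h2 : t < b + ε / 2 := ht.trans_le (min_le_right _ _)
    rw [← hb] at h1
    linarith
  · -- unbounded case: `D ⊇ (-∞, t₁]` and `θ → q` at `-∞`
    have hIic : ∀ t ∈ D, Iic t ⊆ D := fun t ht s hs => by
      obtain ⟨u, huD, hsu⟩ : ∃ u ∈ D, u < s := by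
        by_contra hcon
        push Not at hcon
        exact hbdd ⟨s, fun u hu => (hcon u hu)⟩
      exact hDc.out huD ht ⟨hsu.le, hs⟩
    have hlim' : Tendsto θ atBot (𝓝 q) := by
      have hmap := Filter.map_val_atBot_of_Iic_subset (hIic t₁ t₁.2)
      rw [← hmap, tendsto_map'_iff]
      exact hlim
    -- `θ (t + s) = Φ (θ t) s` for `t ≤ t₁ - ε`, `s ∈ (-ε, ε)`
    have hshift : ∀ t, t ≤ (t₁ : ℝ) - ε → ∀ s ∈ Ioo (-ε) ε, θ (t + s) = Φ (θ t) s := by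
      intro t ht s hs
      have htD : t ∈ D := hIic t₁ t₁.2 (show t ≤ (t₁ : ℝ) by linarith)
      have htU : θ t ∈ U := ht₁ ⟨t, htD⟩ (Subtype.mk_le_mk.2 (by linarith))
      have h1 : IsMIntegralCurveOn (θ ∘ (· + t)) V (Ioo (-ε) ε) := by
        refine (hθ.comp_add t).mono fun s hs => ?_
        exact hIic t₁ t₁.2 (show s + t ≤ (t₁ : ℝ) by have := hs.2; linarith)
      have h2 : IsMIntegralCurveOn (Φ (θ t)) V (Ioo (-ε) ε) := hΦint (θ t) htU
      have h0 : (θ ∘ (· + t)) 0 = Φ (θ t) 0 := by simp [hΦ0 (θ t) htU]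
      have := isMIntegralCurveOn_Ioo_eqOn_of_contMDiff_boundaryless
        (t₀ := 0) ⟨by linarith, hε⟩ hV h1 h2 h0 hs
      simpa [add_comm] using this
    -- hence `Φ q s = q` for `s ∈ (-ε, ε)`
    have hfix : ∀ s ∈ Ioo (-ε) ε, Φ q s = q := by
      intro s hs
      -- `x ↦ Φ x s` is continuous at `q`
      have hcont : ContinuousAt (fun x => Φ x s) q := by
        have h1 : ContinuousWithinAt (fun p : M × ℝ => Φ p.1 p.2) (U ×ˢ Ioo (-ε) ε) (q, s) :=
          (hΦsmooth.continuousOn (q, s) ⟨hqU, hs⟩)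
        have h2 : ContinuousAt (fun p : M × ℝ => Φ p.1 p.2) (q, s) :=
          h1.continuousAt ((hUo.prod isOpen_Ioo).mem_nhds ⟨hqU, hs⟩)
        have h3 : ContinuousAt (fun x : M => (x, s)) q :=
          (continuous_id.prodMk continuous_const).continuousAt
        exact h2.comp_of_eq h3 rfl
      have hA : Tendsto (fun t => Φ (θ t) s) atBot (𝓝 (Φ q s)) := hcont.tendsto.comp hlim'
      have hB : Tendsto (fun t => θ (t + s)) atBot (𝓝 q) :=
        hlim'.comp (tendsto_atBot_add_const_right _ s tendsto_id)
      have hAB : (fun t => θ (t + s)) =ᶠ[atBot] fun t => Φ (θ t) s := by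
        filter_upwards [eventually_le_atBot ((t₁ : ℝ) - ε)] with t ht
        exact hshift t ht s hs
      exact (tendsto_nhds_unique (hB.congr' hAB) hA).symm
    -- the integral curve through `q` is constant near `ε / 2`: `V q = 0`
    have hε2 : ε / 2 ∈ Ioo (-ε) ε := ⟨by linarith, by linarith⟩
    have hd1 : HasMFDerivAt 𝓘(ℝ, ℝ) I (Φ q) (ε / 2)
        ((1 : ℝ →L[ℝ] ℝ).smulRight (V (Φ q (ε / 2)))) :=
      (hΦint q hqU).hasMFDerivAt_of_isOpen isOpen_Ioo hε2
    have hev : (fun _ : ℝ => q) =ᶠ[𝓝 (ε / 2)] Φ q := by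
      filter_upwards [isOpen_Ioo.mem_nhds hε2] with s hs
      exact (hfix s hs).symm
    have hd2 : HasMFDerivAt 𝓘(ℝ, ℝ) I (fun _ : ℝ => q) (ε / 2)
        ((1 : ℝ →L[ℝ] ℝ).smulRight (V (Φ q (ε / 2)))) :=
      hd1.congr_of_eventuallyEq hev
    have hd3 : HasMFDerivAt 𝓘(ℝ, ℝ) I (fun _ : ℝ => q) (ε / 2)
        (0 : TangentSpace 𝓘(ℝ, ℝ) (ε / 2) →L[ℝ] TangentSpace I q) :=
      hasMFDerivAt_const q (ε / 2)
    have heq := (uniqueMDiffWithinAt_univ 𝓘(ℝ, ℝ)).eq hd2.hasMFDerivWithinAt hd3.hasMFDerivWithinAt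
    have : V (Φ q (ε / 2)) = 0 := by
      have := congrArg (fun L : TangentSpace 𝓘(ℝ, ℝ) (ε / 2) →L[ℝ] TangentSpace I q =>
        L (show TangentSpace 𝓘(ℝ, ℝ) (ε / 2) from (1 : ℝ))) heq
      change ((1 : ℝ →L[ℝ] ℝ).smulRight (V (Φ q (ε / 2)))) (1 : ℝ) =
        (0 : ℝ →L[ℝ] TangentSpace I q) (1 : ℝ) at this
      simpa using this
    rw [hfix _ hε2] at this
    exact hV0 q this


/-! ### The maximal flow -/

/-- **The maximal flow of a `C^n` vector field** (`1 ≤ n`), in existential form: there are maps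
`Θ : M → ℝ → M` and `D : M → Set ℝ` such that, for every `x`, `Θ x` is the maximal integral
curve through `x` on the open interval `D x ∋ 0` (`exists_maximal_integralCurve`), with
(i) the **group law** `D (Θ x s) = D x - s` and `Θ (Θ x s) t = Θ x (t + s)` (Lee 2012,
Thm. 9.12 (b)); (ii) **local regularity**: every `x₀` has a neighbourhood `U` and `ε > 0` with
`(-ε, ε) ⊆ D x` for `x ∈ U` and `(x, t) ↦ Θ x t` of class `C^n` on `U × (-ε, ε)` (Lee 2012,
Thm. 9.12 (c)–(d), here only near `t = 0`: `Θ` agrees with a `C^n` local flow,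
`exists_localFlow`, by maximality). [cite: LeeSmoothManifolds2013, Thm. 9.12] -/
theorem exists_maximalFlow {n : ℕ∞}
    (hV : ContMDiff I I.tangent n fun x => (⟨x, V x⟩ : TangentBundle I M)) (hn : 1 ≤ n) :
    ∃ (Θ : M → ℝ → M) (D : M → Set ℝ),
      (∀ x, IsOpen (D x) ∧ (D x).OrdConnected ∧ 0 ∈ D x ∧ Θ x 0 = x ∧
        IsMIntegralCurveOn (Θ x) V (D x) ∧
        ∀ (γ : ℝ → M) (J : Set ℝ), IsOpen J → J.OrdConnected → ∀ t₀ ∈ J, t₀ ∈ D x →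
          γ t₀ = Θ x t₀ → IsMIntegralCurveOn γ V J → J ⊆ D x ∧ EqOn γ (Θ x) J) ∧
      (∀ x, ∀ s ∈ D x, D (Θ x s) = {t | t + s ∈ D x} ∧
        ∀ t, t + s ∈ D x → Θ (Θ x s) t = Θ x (t + s)) ∧
      (∀ x₀, ∃ U : Set M, IsOpen U ∧ x₀ ∈ U ∧ ∃ ε > (0 : ℝ), (∀ x ∈ U, Ioo (-ε) ε ⊆ D x) ∧
        ContMDiffOn (I.prod 𝓘(ℝ, ℝ)) I n (fun p : M × ℝ => Θ p.1 p.2) (U ×ˢ Ioo (-ε) ε)) := by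
  have hV1 : ContMDiff I I.tangent 1 fun x => (⟨x, V x⟩ : TangentBundle I M) :=
    hV.of_le (by exact_mod_cast hn)
  choose Θ D hDo hDc h0 hΘ0 hΘ hmax using exists_maximal_integralCurve (I := I) hV1
  refine ⟨Θ, D, fun x => ⟨hDo x, hDc x, h0 x, hΘ0 x, hΘ x, hmax x⟩, fun x s hs => ?_, fun x₀ => ?_⟩
  · -- group law
    -- the translate of `Θ x` is an integral curve through `Θ x s`
    have hJo : IsOpen {t : ℝ | t + s ∈ D x} := (hDo x).preimage (continuous_add_const s)
    have hJc : {t : ℝ | t + s ∈ D x}.OrdConnected :=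
      ⟨fun a ha b hb u hu => (hDc x).out ha hb ⟨by linarith [hu.1], by linarith [hu.2]⟩⟩
    have h1 := (hmax (Θ x s) (Θ x ∘ (· + s)) {t | t + s ∈ D x} hJo hJc 0 (by simpa using hs)
      (h0 _) (by simp [hΘ0]) ((hΘ x).comp_add s))
    -- the back-translate of `Θ (Θ x s)` is an integral curve through `Θ x s = Θ x s`
    have hJo' : IsOpen {t : ℝ | t + -s ∈ D (Θ x s)} :=
      (hDo _).preimage (continuous_add_const (-s))
    have hJc' : {t : ℝ | t + -s ∈ D (Θ x s)}.OrdConnected :=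
      ⟨fun a ha b hb u hu => (hDc _).out ha hb ⟨by linarith [hu.1], by linarith [hu.2]⟩⟩
    have h2 := (hmax x (Θ (Θ x s) ∘ (· + -s)) {t | t + -s ∈ D (Θ x s)} hJo' hJc' s
      (by simpa using h0 (Θ x s)) hs (by simp [hΘ0]) ((hΘ (Θ x s)).comp_add (-s)))
    refine ⟨Subset.antisymm (fun t ht => ?_) h1.1, fun t ht => (h1.2 ht).symm⟩
    have : t + s ∈ {t : ℝ | t + -s ∈ D (Θ x s)} := by simpa using ht
    exact h2.1 this
  · -- local regularity from a local flow at `x₀`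
    obtain ⟨U, hUo, hx₀U, ε, hε, Φ, hΦ0, hΦint, hΦs⟩ :=
      exists_localFlow hV hn (BoundarylessManifold.isInteriorPoint (x := x₀))
    have hagree : ∀ x ∈ U, Ioo (-ε) ε ⊆ D x ∧ EqOn (Φ x) (Θ x) (Ioo (-ε) ε) := fun x hx =>
      hmax x (Φ x) (Ioo (-ε) ε) isOpen_Ioo ordConnected_Ioo 0 ⟨by linarith, hε⟩ (h0 x)
        (by rw [hΦ0 x hx, hΘ0]) (hΦint x hx)
    refine ⟨U, hUo, hx₀U, ε, hε, fun x hx => (hagree x hx).1, hΦs.congr fun p hp => ?_⟩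
    exact ((hagree p.1 hp.1).2 hp.2).symm

end Maximal



end Literature.Geometry.Manifold

end
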